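import Summits.KontsevichZagierPeriods.Zeta5Search.LaiSweepShard

/-!
# `κ₃` sweep certificate — shard file 063 of 127 (shards 441–447 of 889)

HONEST FRAMING. Systematic search; no irrationality claim unless certified. This file only checks,
by `decide +kernel`, shards 441–447 of the order-cell sweep of the `κ₃` point `(74, 2180, 444; δ74)`
(engine `LaiSweepEngine`, soundness `LaiSweepJump/Free/Eval/Shard/Kappa3`; a shard is `⟨regime, n,
p, q, p', q', Lo, Up⟩`: `n` cells from `p/q` to `p'/q'` with integer rate sums in `[Lo, Up]`, `K =
128`, `D = 2^40`). It draws NO conclusion: only the capstone `LaiKappa3SweepCert`, which needs all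
127 shard files, does. Kernel cost of this file ≈ 560 cells × 0.3 s.
-/

namespace Summit.KontsevichZagierPeriods.Zeta5Search.Sweep

set_option maxHeartbeats 100000000 in
/-- Shard 441: 80 cells of regime B from `183/419` to `145/331`.
[cite: Lai2024BallRivoal, §4 Lemma 4.3] -/
theorem shard441 :
    Shard.check 128 (2^40)
      ⟨true, 80, 183, 419, 145, 331, 17342115007620, 20187616590738⟩ = true := by
  decide +kernel

set_option maxHeartbeats 100000000 in
/-- Shard 442: 80 cells of regime B from `145/331` to `76/173`.
[cite: Lai2024BallRivoal, §4 Lemma 4.3] -/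
theorem shard442 :
    Shard.check 128 (2^40)
      ⟨true, 80, 145, 331, 76, 173, 16351875176131, 19051223533055⟩ = true := by
  decide +kernel

set_option maxHeartbeats 100000000 in
/-- Shard 443: 80 cells of regime B from `76/173` to `63/143`.
[cite: Lai2024BallRivoal, §4 Lemma 4.3] -/
theorem shard443 :
    Shard.check 128 (2^40)
      ⟨true, 80, 76, 173, 63, 143, 16501404170413, 19242171734455⟩ = true := by
  decide +kernel

set_option maxHeartbeats 100000000 in
/-- Shard 444: 80 cells of regime B from `63/143` to `167/378`.
[cite: Lai2024BallRivoal, §4 Lemma 4.3] -/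
theorem shard444 :
    Shard.check 128 (2^40)
      ⟨true, 80, 63, 143, 167, 378, 16278642026533, 18998801472161⟩ = true := by
  decide +kernel

set_option maxHeartbeats 100000000 in
/-- Shard 445: 80 cells of regime B from `167/378` to `144/325`.
[cite: Lai2024BallRivoal, §4 Lemma 4.3] -/
theorem shard445 :
    Shard.check 128 (2^40)
      ⟨true, 80, 167, 378, 144, 325, 16757731934622, 19575062578012⟩ = true := by
  decide +kernel

set_option maxHeartbeats 100000000 in
/-- Shard 446: 80 cells of regime B from `144/325` to `171/385`.
[cite: Lai2024BallRivoal, §4 Lemma 4.3] -/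
theorem shard446 :
    Shard.check 128 (2^40)
      ⟨true, 80, 144, 325, 171, 385, 14107823795670, 16492991425733⟩ = true := by
  decide +kernel

set_option maxHeartbeats 100000000 in
/-- Shard 447: 80 cells of regime B from `171/385` to `86/193`.
[cite: Lai2024BallRivoal, §4 Lemma 4.3] -/
theorem shard447 :
    Shard.check 128 (2^40)
      ⟨true, 80, 171, 385, 86, 193, 18791178451538, 21989320117466⟩ = true := by
  decide +kernel

/-- The checked shards of this file, in order. [folklore] -/
def shards063 : List (CheckedShard 128 (2^40)) :=
  [⟨_, shard441⟩, ⟨_, shard442⟩, ⟨_, shard443⟩, ⟨_, shard444⟩, ⟨_, shard445⟩,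
    ⟨_, shard446⟩, ⟨_, shard447⟩]

end Summit.KontsevichZagierPeriods.Zeta5Search.Sweep
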